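import Mathlib.Tactic.DeriveFintype
import Mathlib.Data.Nat.Log
import Literature.Computability.Complexity.SymbolPrograms
import Literature.Computability.Complexity.BoolEncodings
import HarnessLib

/-!
# Route UniformStream, crux `UniformMagnification` (stmt-PneNP-16047), line `registered`,
# stub `stub_padCore`, part A: registers, unary logarithm, the guard pipeline

The stage-A machines of the padded streaming update (`stub_padCore`, part C) are structured
stack programs over the alphabet `Bool` (`ACom Bool PadCore.Rg` of `SymbolPrograms.lean`,
compiled to `TM2` by `ACom.exists_computesInTime`). This file fixes their register file and
verifies the two arithmetic routines, with exact stores and linear step counts: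

* `PadCore.lg` — the binary logarithm of a unary counter by the loop "pop one unit, halve the
  rest, count one": from `w = 1ᵐ` it adds `⌊log₂ (m + 1)⌋` units to `cnt` within `15 m + 1`
  steps (`PadCore.runs_lg`; the value halves every round, so the cost is a geometric sum; the
  arithmetic is `⌊log₂ (m + 2)⌋ = ⌊log₂ (⌊m / 2⌋ + 1)⌋ + 1`, `PadCore.log2_succ_succ`);
* `PadCore.guardK k` — the test `k · |inp| ≤ |cnt|` on unary counters: `k` guarded pops of `cnt`
  per unit of `inp`, every failed pop leaving a token on the flag register `fl`
  (`PadCore.runs_guardK`: afterwards `fl` has gained `k |inp| ∸ |cnt|` tokens);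
* `PadCore.post k` — the guard pipeline of the stage-A machines: `lg` of `|st|`, plus one, saved;
  `lg` of `|rest|`; `guardK k`: from `w = 1ⁿ`, `t = 1ᴿ` the flag register gains
  `k (⌊log₂(n+1)⌋ + 1) ∸ ⌊log₂(R+1)⌋` tokens within `3 k n + 20 n + 20 R + 3 k + 12` steps
  (`PadCore.runs_post`).

References: T. Nipkow, G. Klein, *Concrete Semantics*, Springer 2014, Ch. 7 (big-step reasoning
about structured programs); S. Arora, B. Barak, *Computational Complexity: A Modern Approach*,
CUP 2009, §1.3 (counters on work tapes, Claim 1.6).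
-/

namespace Summit.PneNP.PneNP.Cruxes.UniformMagnification.Birth

set_option linter.dupNamespace false -- `Summit.PneNP.PneNP.…`: summit = sub-problem (D-0017)

open _root_.Computability Literature.Computability.Complexity

namespace PadCore

open ACom

/-! ### Registers and stores -/

/-- Registers of the stage-A programs: input; outer-parse stack, later the halving scratch; the
kept bit `b`; the reversed prefix `st`; the unary value register `w` of the logarithm routine;
two copies `r`, `t` of `1^{|rest|}`; the logarithm counter `cnt`; the failure flag `fl`; output.
[folklore] -/
inductive Rg
  | inp | s | b | str | w | r | t | cnt | fl | out
  deriving DecidableEq, Fintype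

/-- Stores of the stage-A programs. [folklore] -/
abbrev Store : Type := AStore Bool Rg

/-- Programs over the registers `Rg` and the alphabet `Bool`. [folklore] -/
abbrev Prog : Type := ACom Bool Rg

/-- The store with prescribed register contents. [folklore] -/
def mk (inp s b str w r t cnt fl out : List Bool) : Store
  | .inp => inp
  | .s => s
  | .b => b
  | .str => str
  | .w => w
  | .r => r
  | .t => t
  | .cnt => cnt
  | .fl => fl
  | .out => out

section MkLemmas

variable (i s b str w r t cnt fl o v : List Bool)

/-- Read-out of `inp`. [folklore] -/
@[simp] theorem mk_inp : mk i s b str w r t cnt fl o .inp = i := rfl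
/-- Read-out of `s`. [folklore] -/
@[simp] theorem mk_s : mk i s b str w r t cnt fl o .s = s := rfl
/-- Read-out of `b`. [folklore] -/
@[simp] theorem mk_b : mk i s b str w r t cnt fl o .b = b := rfl
/-- Read-out of `str`. [folklore] -/
@[simp] theorem mk_str : mk i s b str w r t cnt fl o .str = str := rfl
/-- Read-out of `w`. [folklore] -/
@[simp] theorem mk_w : mk i s b str w r t cnt fl o .w = w := rfl
/-- Read-out of `r`. [folklore] -/
@[simp] theorem mk_r : mk i s b str w r t cnt fl o .r = r := rfl
/-- Read-out of `t`. [folklore] -/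
@[simp] theorem mk_t : mk i s b str w r t cnt fl o .t = t := rfl
/-- Read-out of `cnt`. [folklore] -/
@[simp] theorem mk_cnt : mk i s b str w r t cnt fl o .cnt = cnt := rfl
/-- Read-out of `fl`. [folklore] -/
@[simp] theorem mk_fl : mk i s b str w r t cnt fl o .fl = fl := rfl
/-- Read-out of `out`. [folklore] -/
@[simp] theorem mk_out : mk i s b str w r t cnt fl o .out = o := rfl

/-- Update of `inp`. [folklore] -/
@[simp] theorem update_mk_inp :
    Function.update (mk i s b str w r t cnt fl o) .inp v = mk v s b str w r t cnt fl o := by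
  funext x; cases x <;> rfl
/-- Update of `s`. [folklore] -/
@[simp] theorem update_mk_s :
    Function.update (mk i s b str w r t cnt fl o) .s v = mk i v b str w r t cnt fl o := by
  funext x; cases x <;> rfl
/-- Update of `b`. [folklore] -/
@[simp] theorem update_mk_b :
    Function.update (mk i s b str w r t cnt fl o) .b v = mk i s v str w r t cnt fl o := by
  funext x; cases x <;> rfl
/-- Update of `str`. [folklore] -/
@[simp] theorem update_mk_str :
    Function.update (mk i s b str w r t cnt fl o) .str v = mk i s b v w r t cnt fl o := by
  funext x; cases x <;> rfl
/-- Update of `w`. [folklore] -/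
@[simp] theorem update_mk_w :
    Function.update (mk i s b str w r t cnt fl o) .w v = mk i s b str v r t cnt fl o := by
  funext x; cases x <;> rfl
/-- Update of `r`. [folklore] -/
@[simp] theorem update_mk_r :
    Function.update (mk i s b str w r t cnt fl o) .r v = mk i s b str w v t cnt fl o := by
  funext x; cases x <;> rfl
/-- Update of `t`. [folklore] -/
@[simp] theorem update_mk_t :
    Function.update (mk i s b str w r t cnt fl o) .t v = mk i s b str w r v cnt fl o := by
  funext x; cases x <;> rfl
/-- Update of `cnt`. [folklore] -/
@[simp] theorem update_mk_cnt :
    Function.update (mk i s b str w r t cnt fl o) .cnt v = mk i s b str w r t v fl o := by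
  funext x; cases x <;> rfl
/-- Update of `fl`. [folklore] -/
@[simp] theorem update_mk_fl :
    Function.update (mk i s b str w r t cnt fl o) .fl v = mk i s b str w r t cnt v o := by
  funext x; cases x <;> rfl
/-- Update of `out`. [folklore] -/
@[simp] theorem update_mk_out :
    Function.update (mk i s b str w r t cnt fl o) .out v = mk i s b str w r t cnt fl v := by
  funext x; cases x <;> rfl

end MkLemmas

/-- The initial store. [folklore] -/
theorem single_inp (x : List Bool) :
    AStore.single .inp x = mk x [] [] [] [] [] [] [] [] [] := by
  funext q; cases q <;> rfl

/-- The final store. [folklore] -/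
theorem single_out (x : List Bool) :
    AStore.single .out x = mk [] [] [] [] [] [] [] [] [] x := by
  funext q; cases q <;> rfl

/-! ### Unary words and the arithmetic of the logarithm -/

/-- Unary words `1ⁿ`. [folklore] -/
abbrev un (n : ℕ) : List Bool := List.replicate n true

/-- `1ⁿ · 1 · l = 1ⁿ⁺¹ · l`. [folklore] -/
theorem un_append_cons (n : ℕ) (l : List Bool) : un n ++ true :: l = un (n + 1) ++ l := by
  induction n with
  | zero => rfl
  | succ n ih => exact congrArg (List.cons true) ih

/-- `1ᵐ · 1ⁿ = 1ᵐ⁺ⁿ`. [folklore] -/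
theorem un_add (m n : ℕ) : un m ++ un n = un (m + n) := by
  induction m with
  | zero => simp
  | succ m ih => rw [Nat.succ_add]; exact congrArg (List.cons true) ih

/-- The recursion of the logarithm routine: `⌊log₂ (m + 2)⌋ = ⌊log₂ (⌊m / 2⌋ + 1)⌋ + 1`.
[folklore] -/
theorem log2_succ_succ (m : ℕ) : Nat.log 2 (m + 2) = Nat.log 2 (m / 2 + 1) + 1 := by
  rw [Nat.log_of_one_lt_of_le one_lt_two (by omega : 2 ≤ m + 2),
    show (m + 2) / 2 = m / 2 + 1 by omega]

/-! ### The logarithm routine -/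

/-- The inner branch of `halve`: a second unit popped from `w` becomes one unit on the scratch
`s`; a missing partner (odd value) is dropped. [folklore] -/
def halveInner : Option Bool → Prog
  | some _ => push .s true
  | none => skip

/-- `halve`: pair up the units of `w`, one unit on `s` per complete pair: `s` gains `⌊|w| / 2⌋`
units and `w` is emptied. [folklore] -/
def halve : Prog := loop .w fun _ => pop .w halveInner

/-- Effect and cost of `halve` on `w = 1ʲ`: `3 j + 2` steps. [folklore] -/
theorem runs_halve (i b str r t cnt fl o : List Bool) : ∀ (j : ℕ) (s : List Bool),
    Runs halve (mk i s b str (un j) r t cnt fl o) (mk i (un (j / 2) ++ s) b str [] r t cnt fl o)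
      (3 * j + 2)
  | 0, s => by
    have h := Runs.loop_nil (fun _ => pop Rg.w halveInner) (k := Rg.w)
      (R := mk i s b str [] r t cnt fl o) rfl
    exact h.of_eq (by simp) (by norm_num)
  | 1, s => by
    have hbody : Runs (pop Rg.w halveInner) (mk i s b str [] r t cnt fl o)
        (mk i s b str [] r t cnt fl o) 2 :=
      Runs.pop_nil rfl (Runs.skip _)
    have h := Runs.loop_cons' (f := fun _ => pop Rg.w halveInner) (k := Rg.w) (a := true)
      (w := []) (R := mk i s b str (un 1) r t cnt fl o) (R₀ := mk i s b str [] r t cnt fl o)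
      rfl (by simp) hbody (Runs.loop_nil _ rfl)
    exact h.of_eq (by simp) (by norm_num)
  | j + 2, s => by
    have hbody : Runs (pop Rg.w halveInner) (mk i s b str (un (j + 1)) r t cnt fl o)
        (mk i (true :: s) b str (un j) r t cnt fl o) (1 + 2) :=
      Runs.pop_cons' (k := Rg.w) (a := true) (w := un j)
        (R₀ := mk i s b str (un j) r t cnt fl o) rfl (by simp) (Runs.push' (by simp))
    have ih := runs_halve i b str r t cnt fl o j (true :: s)
    have h := Runs.loop_cons' (f := fun _ => pop Rg.w halveInner) (k := Rg.w) (a := true)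
      (w := un (j + 1)) (R := mk i s b str (un (j + 2)) r t cnt fl o)
      (R₀ := mk i s b str (un (j + 1)) r t cnt fl o) rfl (by simp) hbody ih
    refine h.of_eq ?_ (by omega)
    rw [un_append_cons, show j / 2 + 1 = (j + 2) / 2 by omega]

/-- The body of `lg`: halve the remaining value (through the scratch `s`, poured back onto `w`)
and count one unit on `cnt`. [folklore] -/
def lgBody : Prog := halve ;; pour .s .w ;; push .cnt true

/-- `lg`: while `w` is nonempty: pop one unit, halve the rest, count one unit on `cnt`. From
`w = 1ᵐ` this runs `⌊log₂ (m + 1)⌋` rounds, of geometrically decreasing costs. [folklore] -/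
def lg : Prog := loop .w fun _ => lgBody

/-- **Effect and cost of `lg`**: from `w = 1ᵐ` with empty scratch `s`, the counter `cnt` gains
`⌊log₂ (m + 1)⌋` units and `w` is emptied, within `9 m + 6 ⌊log₂ (m + 1)⌋ + 1` steps. [folklore] -/
theorem runs_lg (i b str r t fl o : List Bool) (m : ℕ) : ∀ cnt : List Bool,
    Runs lg (mk i [] b str (un m) r t cnt fl o)
      (mk i [] b str [] r t (un (Nat.log 2 (m + 1)) ++ cnt) fl o)
      (9 * m + 6 * Nat.log 2 (m + 1) + 1) := by
  induction m using Nat.strong_induction_on with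
  | _ m ih =>
  intro cnt
  cases m with
  | zero =>
    have h := Runs.loop_nil (fun _ => lgBody) (k := Rg.w) (R := mk i [] b str [] r t cnt fl o) rfl
    exact h.of_eq (by simp) (by norm_num)
  | succ m =>
    have h1 := runs_halve i b str r t cnt fl o m []
    rw [List.append_nil] at h1
    have h2 := runs_pour (Γ := Bool) (a := Rg.s) (b := Rg.w) (by decide)
      (mk i (un (m / 2)) b str [] r t cnt fl o)
    simp only [mk_s, mk_w, List.append_nil, List.reverse_replicate, update_mk_s, update_mk_w,
      List.length_replicate] at h2
    have h3 : Runs (push Rg.cnt true) (mk i [] b str (un (m / 2)) r t cnt fl o)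
        (mk i [] b str (un (m / 2)) r t (true :: cnt) fl o) 1 := Runs.push' (by simp)
    have hbody : Runs lgBody (mk i [] b str (un m) r t cnt fl o)
        (mk i [] b str (un (m / 2)) r t (true :: cnt) fl o)
        (3 * m + 2 + (3 * (m / 2) + 1 + 1)) :=
      h1.seq (h2.seq h3)
    have ih' := ih (m / 2) (by omega) (true :: cnt)
    have h := Runs.loop_cons' (f := fun _ => lgBody) (k := Rg.w) (a := true) (w := un m)
      (R := mk i [] b str (un (m + 1)) r t cnt fl o) (R₀ := mk i [] b str (un m) r t cnt fl o)
      rfl (by simp) hbody ih'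
    have e : Nat.log 2 (m + 1 + 1) = Nat.log 2 (m / 2 + 1) + 1 := log2_succ_succ m
    refine h.of_eq ?_ (by omega)
    rw [un_append_cons, e]

/-- The cost of `lg` is linear: at most `15 m + 1` steps (`⌊log₂ (m + 1)⌋ ≤ m`). [folklore] -/
theorem runs_lg' (i b str r t cnt fl o : List Bool) (m : ℕ) :
    Runs lg (mk i [] b str (un m) r t cnt fl o)
      (mk i [] b str [] r t (un (Nat.log 2 (m + 1)) ++ cnt) fl o) (15 * m + 1) := by
  have h := (Nat.log_lt_iff_lt_pow one_lt_two (Nat.add_one_ne_zero m)).2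
    (Nat.lt_two_pow_self (n := m + 1))
  exact (runs_lg i b str r t fl o m cnt).mono (by omega)

/-! ### The guard -/

/-- `popK j`: `j` guarded pops of `cnt`, every failed one (on empty `cnt`) leaving a token on
`fl`. [folklore] -/
def popK : ℕ → Prog
  | 0 => skip
  | j + 1 => pop .cnt fun o => match o with
    | some _ => popK j
    | none => push .fl true ;; popK j

/-- Effect and cost of `popK j` on `cnt = 1ⁿ`: `cnt := 1^{n ∸ j}`, `fl` gains `j ∸ n` tokens,
`3 j` steps. [folklore] -/
theorem runs_popK (i s b str w r t o : List Bool) : ∀ (j n : ℕ) (fl : List Bool),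
    Runs (popK j) (mk i s b str w r t (un n) fl o)
      (mk i s b str w r t (un (n - j)) (un (j - n) ++ fl) o) (3 * j)
  | 0, n, fl => by simpa [popK] using Runs.skip (mk i s b str w r t (un n) fl o)
  | j + 1, 0, fl => by
    rw [popK]
    have h1 : Runs (push Rg.fl true) (mk i s b str w r t (un 0) fl o)
        (mk i s b str w r t (un 0) (true :: fl) o) 1 := Runs.push' (by simp)
    have h2 := runs_popK i s b str w r t o j 0 (true :: fl)
    have h := Runs.pop_nil (k := Rg.cnt) (f := fun o => match o with
      | some _ => popK j
      | none => push .fl true ;; popK j) (R := mk i s b str w r t (un 0) fl o) rfl (h1.seq h2)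
    refine h.of_eq ?_ (by omega)
    rw [un_append_cons, Nat.zero_sub, Nat.zero_sub, Nat.sub_zero, Nat.sub_zero]
  | j + 1, n + 1, fl => by
    rw [popK]
    have h2 := runs_popK i s b str w r t o j n fl
    have h := Runs.pop_cons' (k := Rg.cnt) (a := true) (w := un n) (f := fun o => match o with
      | some _ => popK j
      | none => push .fl true ;; popK j) (R := mk i s b str w r t (un (n + 1)) fl o)
      (R₀ := mk i s b str w r t (un n) fl o) rfl (by simp) h2
    refine h.of_eq ?_ (by omega)
    rw [Nat.add_sub_add_right, Nat.add_sub_add_right]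

/-- `guardK k`: for every unit of `inp`, `k` guarded pops of `cnt`. [folklore] -/
def guardK (k : ℕ) : Prog := loop .inp fun _ => popK k

/-- **Effect and cost of `guardK k`** on `inp = 1ᵃ`, `cnt = 1ᴮ`: `inp` is emptied,
`cnt := 1^{B ∸ k a}`, `fl` gains `k a ∸ B` tokens; `(3 k + 2) a + 1` steps. So `fl` stays
unchanged exactly when `k a ≤ B`. [folklore] -/
theorem runs_guardK (k : ℕ) (s b str w r t fl o : List Bool) (a B : ℕ) :
    Runs (guardK k) (mk (un a) s b str w r t (un B) fl o)
      (mk [] s b str w r t (un (B - k * a)) (un (k * a - B) ++ fl) o)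
      (3 * (k * a) + 2 * a + 1) := by
  have h := runs_loop_inv (k := Rg.inp) (f := fun _ => popK k)
    (fun done rest => mk rest s b str w r t (un (B - k * done.length))
      (un (k * done.length - B) ++ fl) o)
    (fun _ _ => True) (3 * k)
    (fun _ _ _ => rfl)
    (fun done x rest _ => ⟨trivial, by
      simp only [update_mk_inp, List.length_cons]
      have h := runs_popK rest s b str w r t o k (B - k * done.length)
        (un (k * done.length - B) ++ fl)
      refine h.of_eq ?_ le_rfl
      rw [← List.append_assoc, un_add, mul_add_one,
        show B - k * done.length - k = B - (k * done.length + k) by omega,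
        show k - (B - k * done.length) + (k * done.length - B) = k * done.length + k - B by omega]⟩)
    (un a) [] trivial
  simp only [List.length_nil, Nat.mul_zero, Nat.sub_zero, Nat.zero_sub, un, List.replicate_zero,
    List.nil_append, List.reverse_replicate, List.append_nil, List.length_replicate] at h
  exact h.mono (le_of_eq (by ring))

/-! ### The guard pipeline -/

/-- `post k`: the logarithm of `|st|` (on `w`), plus one, saved on `inp`; the logarithm of `|rest|`
(moved from `t` to `w`); the guard; clearing the leftover count. [folklore] -/
def post (k : ℕ) : Prog :=
  lg ;; push .cnt true ;; pour .cnt .inp ;; pour .t .w ;; lg ;; guardK k ;; clear .cnt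

/-- **Effect and cost of `post k`** from `w = 1ⁿ`, `t = 1ᴿ` (scratch registers empty): everything
is consumed and the flag register gains `k (⌊log₂(n+1)⌋ + 1) ∸ ⌊log₂(R+1)⌋` tokens, within
`3 k n + 20 n + 20 R + 3 k + 12` steps. [folklore] -/
theorem runs_post (k : ℕ) (b str r fl o : List Bool) (n R : ℕ) :
    Runs (post k) (mk [] [] b str (un n) r (un R) [] fl o)
      (mk [] [] b str [] r [] [] (un (k * (Nat.log 2 (n + 1) + 1) - Nat.log 2 (R + 1)) ++ fl) o)
      (3 * (k * n) + 20 * n + 20 * R + 3 * k + 12) := by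
  unfold post
  have h1 := runs_lg' [] b str r (un R) [] fl o n
  rw [List.append_nil] at h1
  have h2 : Runs (push Rg.cnt true) (mk [] [] b str [] r (un R) (un (Nat.log 2 (n + 1))) fl o)
      (mk [] [] b str [] r (un R) (un (Nat.log 2 (n + 1) + 1)) fl o) 1 :=
    Runs.push' (by rw [update_mk_cnt, mk_cnt]; rfl)
  have h3 := runs_pour (Γ := Bool) (a := Rg.cnt) (b := Rg.inp) (by decide)
    (mk [] [] b str [] r (un R) (un (Nat.log 2 (n + 1) + 1)) fl o)
  simp only [mk_cnt, mk_inp, List.reverse_replicate, List.append_nil, update_mk_cnt,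
    update_mk_inp, List.length_replicate] at h3
  have h4 := runs_pour (Γ := Bool) (a := Rg.t) (b := Rg.w) (by decide)
    (mk (un (Nat.log 2 (n + 1) + 1)) [] b str [] r (un R) [] fl o)
  simp only [mk_t, mk_w, List.reverse_replicate, List.append_nil, update_mk_t, update_mk_w,
    List.length_replicate] at h4
  have h5 := runs_lg' (un (Nat.log 2 (n + 1) + 1)) b str r [] [] fl o R
  rw [List.append_nil] at h5
  have h6 := runs_guardK k [] b str [] r [] fl o (Nat.log 2 (n + 1) + 1) (Nat.log 2 (R + 1))
  have h7 := runs_clear (Γ := Bool) Rg.cnt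
    (mk [] [] b str [] r [] (un (Nat.log 2 (R + 1) - k * (Nat.log 2 (n + 1) + 1)))
      (un (k * (Nat.log 2 (n + 1) + 1) - Nat.log 2 (R + 1)) ++ fl) o)
  simp only [mk_cnt, update_mk_cnt, List.length_replicate] at h7
  refine (h1.seq (h2.seq (h3.seq (h4.seq (h5.seq (h6.seq h7)))))).of_eq rfl ?_
  have ha := (Nat.log_lt_iff_lt_pow one_lt_two (Nat.add_one_ne_zero n)).2
    (Nat.lt_two_pow_self (n := n + 1))
  have hB := (Nat.log_lt_iff_lt_pow one_lt_two (Nat.add_one_ne_zero R)).2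
    (Nat.lt_two_pow_self (n := R + 1))
  have hk : k * (Nat.log 2 (n + 1) + 1) = k * Nat.log 2 (n + 1) + k := mul_add_one k _
  have hkn : k * Nat.log 2 (n + 1) ≤ k * n := Nat.mul_le_mul_left k (by omega)
  omega

end PadCore

end Summit.PneNP.PneNP.Cruxes.UniformMagnification.Birth
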